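import Summits.HodgeConjecture.HodgeConjecture.Theorems.Ring2AbelianAllAndreTransportLattice
import HarnessLib

/-!
# Ring 2 · sub-cell AbelianAll (ALL ABELIAN VARIETIES), André axis, part XVII-e — THE KERNELS `ker j_s^*` DO NOT DEPEND
# ON THE FIBRE, so in the lattice of part XVII-b the right-hand side `N^p(𝒳) ⊔ ker j_s^*` is CONSTANT: transport
# (1.1)_f plus the lift (L) at ONE point is the algebraic fixed part (L∀) on that pencil, and on CM-pointed pencils
# **(L∀) ⟺ (3) ∧ (L)**

HONEST FRAMING (page 1, verbatim): **research route, not a corollary; conditional on HC_CM plus one named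
minimal statement.** Cell line: research route conditional on HC_CM; not a corollary; Q11.4-sentence-2
already refuted in dim ≥ 3. Nothing in this file proves a case of the Hodge conjecture for an abelian variety.
`HC_CM` = `Theses.RankFourFaces.CMAbelianHodge` does not occur in this file; item `Theses.RankFourFaces.CMToAbelian`
(stmt-16267) OPEN and not closed here. Seat `pub-hodge-ring2-ab-andre-2`, gen 9 (sequel of parts XVII-a/b).

## What is proved (theorems only; no definition, no named fact, no sorry)

* `ker_map_fiberι_eq` — on a compact pencil `ker j_s^* = ker j_t^*` in every degree (André's flatness (A4): a global
  class dying on one fibre dies on all), hence `algebraicClasses_sup_ker_eq`: `N^p(𝒳) ⊔ ker j_s^* = N^p(𝒳) ⊔ ker j_t^*`.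
* **`comap_eq_sup_of_comap_eq_of_le`** — lattice step: if `s ↦ (j_s^*)⁻¹N^p(𝒳_s)` is constant ((1.1)_f, part XVII-b)
  and `(j_t^*)⁻¹N^p(𝒳_t) ≤ N^p(𝒳) ⊔ ker j_t^*` at ONE point `t` ((L) there), then
  `(j_s^*)⁻¹N^p(𝒳_s) = N^p(𝒳) ⊔ ker j_s^*` at EVERY point ((L∀) on this pencil).
* **`algebraicFixedPart_cmPointed_iff` — on CM-pointed compact pencils of abelian varieties, the algebraic fixed part
  (L∀) is EXACTLY transport (3) plus the CM-fibre lift (L)**: (∀ compact pencils with a CM fibre, ∀ p s,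
  `(j_s^*)⁻¹N^p(𝒳_s) = N^p(𝒳) ⊔ ker j_s^*`) ⟺ `CMPointedPencilVHC ∧ CMFibreAlgebraicLift`. (⟸ is the new edge;
  ⟹: (L∀)|_f gives (1.1)_f by constancy of the right-hand side, and (L) is its instance at CM points.)
* `algebraicFixedPart_iff_compactAbelianPencilVHC_and_lift` — likewise on ALL compact pencils:
  `AlgebraicFixedPart` ⟺ `CompactAbelianPencilVHC` ∧ "lift at ONE point of every compact pencil".

READING (RING2-MAP §AbelianAll gen 9). New K-edges: (3) ∧ (L) ⟹ (L∀)|_{CM-pointed}; (2) ∧ (lift at one point per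
pencil) ⟺ (L∀). With part I ((L∀) ⟹ (2) ⟹ (3) ⟹ (4), (L∀) ⟹ (L) ⟹ (4)) the square closes on CM-pointed pencils:
**(L∀)_CM = (3) ∧ (L)**, i.e. the two weakenings of the algebraic fixed part used on the André axis — "transport
along the pencil" and "lift at the CM fibre" — lose nothing when taken together. EDGE LABELS: K unconditional; no def,
no named fact, no Hodge-conjecture input, `HC_CM` absent.

References: DeligneHodgeII1971 (Thm. 4.1.1, Cor. 4.1.2); Andre1996Motifs (§5.1 (A4) p. 25, §6.3 p. 33);
Abdulali1994FamiliesAV ((1.1) p. 1122); Milne2020HodgeClassesAV (Prop. 1); GrothendieckTopology1969 (§1).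
-/

noncomputable section

set_option linter.dupNamespace false

namespace Summit.HodgeConjecture.HodgeConjecture.Ring2.AbelianAll

open CategoryTheory AlgebraicGeometry
open Literature.AlgebraicGeometry Literature.AlgebraicGeometry.Motives
open Literature.AlgebraicGeometry.HodgeTheory
open Literature.AlgebraicGeometry.Abdulali1994 (InvariantCyclesHoldFor)
open Literature.AlgebraicGeometry.Deligne1982 (cmLocus)
open Summit.HodgeConjecture.HodgeConjecture.Ring2.Deform (CompactAbelianPencilVHC)

variable {𝒳 S : SchemeOver ℂ}

/-! ## §1 The kernels of the fibre restrictions coincide -/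

/-- **`ker j_s^* = ker j_t^*`** on a compact pencil of abelian `d`-folds, in every degree (André's flatness (A4),
`map_fiberι_eq_zero_of_eq_zero`: the restrictions of a global class form a flat section over the connected base).
[cite: Andre1996Motifs, §5.1 (p. 25)] [cite: DeligneHodgeII1971, Thm. 4.1.1] -/
theorem ker_map_fiberι_eq {d : ℕ} {f : 𝒳 ⟶ S} (hf : IsCompactAbelianPencil f d) (k : ℕ) (s t : ComplexPoints S) :
    LinearMap.ker (complexBetti.map (fiberι f s) k).hom = LinearMap.ker (complexBetti.map (fiberι f t) k).hom := by
  ext W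
  simp only [LinearMap.mem_ker]
  exact ⟨fun h ↦ map_fiberι_eq_zero_of_eq_zero hf h t, fun h ↦ map_fiberι_eq_zero_of_eq_zero hf h s⟩

/-- Hence `N^p(𝒳) ⊔ ker j_s^* = N^p(𝒳) ⊔ ker j_t^*`: the right-hand side of part XVII-b's lattice identities does
not depend on the fibre. [cite: Andre1996Motifs, §5.1 (p. 25)] -/
theorem algebraicClasses_sup_ker_eq {d : ℕ} {f : 𝒳 ⟶ S} (hf : IsCompactAbelianPencil f d) (p : ℕ)
    (s t : ComplexPoints S) :
    algebraicClasses 𝒳 p ⊔ LinearMap.ker (complexBetti.map (fiberι f s) (2 * p)).hom =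
      algebraicClasses 𝒳 p ⊔ LinearMap.ker (complexBetti.map (fiberι f t) (2 * p)).hom := by
  rw [ker_map_fiberι_eq hf (2 * p) s t]

/-! ## §2 Transport plus lift at one point is the algebraic fixed part -/

/-- **Lattice step: (1.1)_f ∧ (L)|_{f,t} ⟹ (L∀)|_f.** If the subspaces `(j_s^*)⁻¹N^p(𝒳_s)` do not depend on `s` and
at ONE point `t` one has `(j_t^*)⁻¹N^p(𝒳_t) ≤ N^p(𝒳) ⊔ ker j_t^*`, then `(j_s^*)⁻¹N^p(𝒳_s) = N^p(𝒳) ⊔ ker j_s^*`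
for every `s` (`⊇` always, part XVII-b; `ker j_s^*` is constant, §1). [cite: Abdulali1994FamiliesAV, (1.1) (p. 1122)]
[cite: Milne2020HodgeClassesAV, Prop. 1 (p. 7)] -/
theorem comap_eq_sup_of_comap_eq_of_le {d : ℕ} {f : 𝒳 ⟶ S} (hf : IsCompactAbelianPencil f d) (p : ℕ)
    (hconst : ∀ s s' : ComplexPoints S,
      (algebraicClasses (fiberOver f s) p).comap (complexBetti.map (fiberι f s) (2 * p)).hom =
        (algebraicClasses (fiberOver f s') p).comap (complexBetti.map (fiberι f s') (2 * p)).hom)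
    {t : ComplexPoints S}
    (ht : (algebraicClasses (fiberOver f t) p).comap (complexBetti.map (fiberι f t) (2 * p)).hom ≤
      algebraicClasses 𝒳 p ⊔ LinearMap.ker (complexBetti.map (fiberι f t) (2 * p)).hom)
    (s : ComplexPoints S) :
    (algebraicClasses (fiberOver f s) p).comap (complexBetti.map (fiberι f s) (2 * p)).hom =
      algebraicClasses 𝒳 p ⊔ LinearMap.ker (complexBetti.map (fiberι f s) (2 * p)).hom :=
  le_antisymm (by rw [hconst s t, algebraicClasses_sup_ker_eq hf p s t]; exact ht)
    (algebraicClasses_sup_ker_le_comap hf p s)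

/-- **(1.1)_f ∧ "lift at one point" ⟹ (L∀)|_f, in the `∃ η` form.** [cite: Abdulali1994FamiliesAV, (1.1) (p. 1122)]
[cite: Milne2020HodgeClassesAV, Prop. 1 (p. 7)] -/
theorem exists_lift_of_invariantCyclesHoldFor_of_liftAt {d : ℕ} {f : 𝒳 ⟶ S} (hf : IsCompactAbelianPencil f d)
    (hV : InvariantCyclesHoldFor f d) {p : ℕ} {t : ComplexPoints S}
    (hL : ∀ W : complexBetti 𝒳 (2 * p),
      complexBetti.map (fiberι f t) (2 * p) W ∈ algebraicClasses (fiberOver f t) p →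
      ∃ η ∈ algebraicClasses 𝒳 p,
        complexBetti.map (fiberι f t) (2 * p) η = complexBetti.map (fiberι f t) (2 * p) W)
    (s : ComplexPoints S) (W : complexBetti 𝒳 (2 * p))
    (hW : complexBetti.map (fiberι f s) (2 * p) W ∈ algebraicClasses (fiberOver f s) p) :
    ∃ η ∈ algebraicClasses 𝒳 p,
      complexBetti.map (fiberι f s) (2 * p) η = complexBetti.map (fiberι f s) (2 * p) W := by
  have hconst := (invariantCyclesHoldFor_iff_comap_eq hf).1 hV p
  have ht : (algebraicClasses (fiberOver f t) p).comap (complexBetti.map (fiberι f t) (2 * p)).hom ≤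
      algebraicClasses 𝒳 p ⊔ LinearMap.ker (complexBetti.map (fiberι f t) (2 * p)).hom := by
    intro W' hW'
    obtain ⟨η, hη, hηt⟩ := hL W' hW'
    rw [show W' = η + (W' - η) by abel]
    refine Submodule.add_mem_sup hη ?_
    rw [LinearMap.mem_ker, map_sub, sub_eq_zero]
    exact hηt.symm
  have hs : W ∈ (algebraicClasses (fiberOver f s) p).comap (complexBetti.map (fiberι f s) (2 * p)).hom := hW
  rw [comap_eq_sup_of_comap_eq_of_le hf p hconst ht s] at hs
  obtain ⟨η, hη, κ, hκ, hW'⟩ := Submodule.mem_sup.1 hs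
  refine ⟨η, hη, ?_⟩
  rw [LinearMap.mem_ker] at hκ
  rw [← hW', map_add]
  change _ = _ + (complexBetti.map (fiberι f s) (2 * p)).hom κ
  rw [hκ, add_zero]

/-- **On CM-pointed compact pencils, (L∀) ⟺ (3) ∧ (L).** The algebraic fixed part on every compact pencil of abelian
varieties HAVING A CM FIBRE (stated in lattice form) is equivalent to the conjunction of `CMPointedPencilVHC`
(transport (1.1) on such pencils) and `CMFibreAlgebraicLift` (lift at CM fibres). ⟸ is `comap_eq_sup_of_comap_eq_of_le`;
⟹: the identity makes `(j_s^*)⁻¹N^p(𝒳_s)` constant (§1) and contains (L) at CM points.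
[cite: Andre1996Motifs, Lemme 6.3.1 (p. 31) and §6.3 (p. 33)] [cite: Milne2020HodgeClassesAV, Prop. 1 (p. 7)]
[cite: Abdulali1994FamiliesAV, (1.1) (p. 1122)] -/
theorem algebraicFixedPart_cmPointed_iff :
    (∀ ⦃d : ℕ⦄ ⦃𝒳 S : SchemeOver ℂ⦄ (f : 𝒳 ⟶ S) (hf : IsCompactAbelianPencil f d), (cmLocus f d).Nonempty →
      ∀ (p : ℕ) (s : ComplexPoints S),
        (algebraicClasses (fiberOver f s) p).comap (complexBetti.map (fiberι f s) (2 * p)).hom =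
          algebraicClasses 𝒳 p ⊔ LinearMap.ker (complexBetti.map (fiberι f s) (2 * p)).hom) ↔
      CMPointedPencilVHC ∧ CMFibreAlgebraicLift := by
  refine ⟨fun h ↦ ⟨?_, ?_⟩, fun ⟨h3, hL⟩ d 𝒳 S f hf hne p s ↦ ?_⟩
  · intro d 𝒳 S f hf hne
    rw [invariantCyclesHoldFor_iff_comap_eq hf]
    intro p s s'
    rw [h f hf hne p s, h f hf hne p s', algebraicClasses_sup_ker_eq hf p s s']
  · rw [cmFibreAlgebraicLift_iff_comap_le_sup]
    intro d 𝒳 S f hf p t ht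
    exact (h f hf ⟨t, ht⟩ p t).le
  · obtain ⟨t, ht⟩ := hne
    exact comap_eq_sup_of_comap_eq_of_le hf p ((invariantCyclesHoldFor_iff_comap_eq hf).1 (h3 f hf ⟨t, ht⟩) p)
      (cmFibreAlgebraicLift_iff_comap_le_sup.1 hL f hf p t ht) s

/-- **(L∀) ⟺ (2) ∧ "lift at ONE point of every compact pencil"** (the point may depend on the pencil).
[cite: Milne2020HodgeClassesAV, Prop. 1 (p. 7)] [cite: Abdulali1994FamiliesAV, (1.1) (p. 1122)] -/
theorem algebraicFixedPart_iff_compactAbelianPencilVHC_and_lift :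
    AlgebraicFixedPart ↔ CompactAbelianPencilVHC ∧
      ∀ ⦃d : ℕ⦄ ⦃𝒳 S : SchemeOver ℂ⦄ (f : 𝒳 ⟶ S), IsCompactAbelianPencil f d →
        ∃ t : ComplexPoints S, ∀ (p : ℕ),
          (algebraicClasses (fiberOver f t) p).comap (complexBetti.map (fiberι f t) (2 * p)).hom ≤
            algebraicClasses 𝒳 p ⊔ LinearMap.ker (complexBetti.map (fiberι f t) (2 * p)).hom := by
  refine ⟨fun h ↦ ⟨compactAbelianPencilVHC_of_algebraicFixedPart h, fun d 𝒳 S f hf ↦ ?_⟩, fun ⟨h2, hL⟩ ↦ ?_⟩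
  · -- a point of the (infinite) base curve
    haveI : IsIntegral S.left := IsSmoothProjective.isIntegral_holds hf.isSmoothProjective_base
    haveI : SmoothOfRelativeDimension 1 S.hom := hf.isSmoothProjective_base.smoothOfRelativeDimension
    haveI : Infinite (ComplexPoints S) := Motives.infinite_algPoints S
    obtain ⟨t⟩ := (inferInstance : Infinite (ComplexPoints S)).nonempty
    exact ⟨t, fun p ↦ (algebraicFixedPart_iff_comap_eq_sup.1 h f hf p t).le⟩
  · rw [algebraicFixedPart_iff_comap_eq_sup]
    intro d 𝒳 S f hf p s
    obtain ⟨t, ht⟩ := hL f hf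
    exact comap_eq_sup_of_comap_eq_of_le hf p ((invariantCyclesHoldFor_iff_comap_eq hf).1 (h2 f hf) p) (ht p) s

end Summit.HodgeConjecture.HodgeConjecture.Ring2.AbelianAll

end
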